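import Mathlib
import HarnessLib
import Summits.QuantumAdvantage.QuantumAdvantage.Theorems.PumpDialF
import Summits.QuantumAdvantage.QuantumAdvantage.Theorems.WalkFiniteStateNoPerfect

/-!
# PumpDial, part G (sections Immunity, PolyPumpE, EvenCut, EvenThird) — support for item stmt-QuantumAdvantage-28487

Cell decomp-qadv, seat lens-4 («minimal counterexample / extremal reduction»), generation 25 — land port of the node
«PumpDial» (published under the cell's HOME/decomp-qadv-lens-4/g25/PumpDial.lean rev 3, sha256 59c460875773e61d…, record NODE-g25.md;
RESIDUAL MODE on AbsorptionDial:28487 `NoPerfectPolyOdd`).  The node file with ONLY the namespace renamed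
`Theses.PumpDial → Theorems.PumpDial`, `example`s dropped and one-line docstrings added where missing, cut into chain-imported parts;
the X-side junction theorems (conclusion `AbsorptionDial.NoPerfectPolyOdd` BY NAME) live in the LAST part, the only one importing
`Theses.AbsorptionDial`; every other part imports only `AdviceFreeQNC0.*`, `Literature.Computability.MetaComplexity.*`, HarnessLib, Mathlib
(no import path to any Theses file — checked on the tree's import lines), so route items can be typed BY NAME over these parts.
No `sorry`, no new axioms, no instances, no notation.

This part: `three_ne_zero_zmod` … `evenCutThird_endCase` (35 declarations).
-/

set_option autoImplicit false
set_option linter.dupNamespace false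

noncomputable section

namespace Summit.QuantumAdvantage.QuantumAdvantage.Theorems.PumpDial
open Classical
open Finset
open Summit.QuantumAdvantage.AdviceFreeQNC0
open Summit.QuantumAdvantage.AdviceFreeQNC0.TwoShot
open Summit.QuantumAdvantage.AdviceFreeQNC0.CharK
open Literature.Computability.MetaComplexity Literature.Computability.MetaComplexity.Smolensky

section Immunity

variable {K : Type*} [Field K] {n : ℕ}

/-- `three_ne_zero_zmod` (PumpDial g25, section Immunity). -/
theorem three_ne_zero_zmod {p : ℕ} [Fact p.Prime] (hp : 5 ≤ p) : (3 : ZMod p) ≠ 0 := by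
  intro h
  have h' : ((3 : ℕ) : ZMod p) = 0 := by exact_mod_cast h
  rw [CharP.cast_eq_zero_iff (ZMod p) p] at h'
  have := Nat.le_of_dvd (by norm_num) h'
  omega

/-- the rung in the route's field: for every prime `p ≥ 5`, every off-diagonal board and `3d + 2 ≤ n`. -/
theorem not_endUnityAt_zmod {p : ℕ} [Fact p.Prime] (hp : 5 ≤ p) {c d : ℕ} (hc : c % 3 ≠ n % 3)
    (hd : 3 * d + 2 ≤ n) : ¬ EndUnityAt (ZMod p) n c d :=
  not_endUnityAt (three_ne_zero_zmod hp) hc hd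

end Immunity

section PolyPumpE

variable {p : ℕ} [Fact p.Prime]

/-! ## §19  `PolyPumpE k` — the even-start pump family IS A CHAIN (answer to critic row 66v46)

`PolyPump k` quantifies over odd diagonal start boards too, and no law in hand transports a fixed-degree
non-unity UP from an odd diagonal board (the one-bit off-diagonal restriction is not hardness-preserving, §7 of the
memo), so `PolyPump k → PolyPump (k+1)` is not derivable from the board calculus.  Its EVEN-START form is: by law M
(`stair_from`) a longer gadget only adds K-hard length.  `PolyPumpE k` is WEAKER than `PolyPump k`
(`polyPumpE_of_polyPump`), monotone in `k` (`polyPumpE_mono`), and still closes `B_K` and `X` for every fixed `k`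
(`closes_K_polyE`, `closes_X_polyE`) — so it supersedes `PolyPump k` as the right-sized piece. -/

/-- **piece `PolyPumpE k`** (single prime) [crux-candidate · UNDECIDED for every `k` · X-INCOMPARABLE · a CHAIN in `k`
· `PolyPump k → PolyPumpE k` · `PUMP → PolyPumpE 0`]: a pump from EVEN off-diagonal boards only. -/
def PolyPumpEAt (p : ℕ) [Fact p.Prime] (k : ℕ) : Prop :=
  ∀ m c d : ℕ, 4 ≤ m → EvenOff m c → ¬ UnityAt (ZMod p) m c d →
    ¬ UnityAt (ZMod p) (m + 6 * (d + 1) ^ k) c (d + 1)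

/-- `PolyPumpE k` for every prime `p ≥ 5`. -/
def PolyPumpE (k : ℕ) : Prop := ∀ (p : ℕ) [Fact p.Prime], 5 ≤ p → PolyPumpEAt p k

/-- `polyPumpE_of_polyPump` (PumpDial g25, section PolyPumpE). -/
theorem polyPumpE_of_polyPump {k : ℕ} (h : PolyPumpAt p k) : PolyPumpEAt p k :=
  fun m c d hm hE hU => h m c d hm (Or.inr hE) hU

/-- `polyPumpE_of_polyPump'` (PumpDial g25, section PolyPumpE). -/
theorem polyPumpE_of_polyPump' {k : ℕ} (h : PolyPump k) : PolyPumpE k :=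
  fun p _ hp => polyPumpE_of_polyPump (h p hp)

/-- `polyPumpE_zero_of_pump` (PumpDial g25, section PolyPumpE). -/
theorem polyPumpE_zero_of_pump (hP : UnityPump) : PolyPumpE 0 :=
  polyPumpE_of_polyPump' (polyPump_zero_of_pump hP)

/-- **the chain property** (law M): `PolyPumpE k → PolyPumpE (k+1)`. -/
theorem polyPumpE_mono {k : ℕ} (h : PolyPumpEAt p k) : PolyPumpEAt p (k + 1) := by
  intro m c d hm hE hU
  have h1 := h m c d hm hE hU
  obtain ⟨hE1, hE2⟩ := hE
  have hm2 : (m + 6 * (d + 1) ^ k) % 2 = 0 := by omega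
  have hc3 : c % 3 ≠ (m + 6 * (d + 1) ^ k) % 3 := by omega
  have hle : (d + 1) ^ k ≤ (d + 1) ^ (k + 1) := Nat.pow_le_pow_right (Nat.succ_pos d) (Nat.le_succ k)
  exact stair_from hm2 hc3 h1 (m + 6 * (d + 1) ^ (k + 1)) c (by omega) (Or.inr ⟨by omega, by omega⟩)

/-- `polyPumpE_of_le` (PumpDial g25, section PolyPumpE). -/
theorem polyPumpE_of_le {k k' : ℕ} (hk : k ≤ k') (h : PolyPumpEAt p k) : PolyPumpEAt p k' := by
  induction hk with
  | refl => exact h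
  | step _ ih => exact polyPumpE_mono ih

/-- `polyPumpE_chain` (PumpDial g25, section PolyPumpE). -/
theorem polyPumpE_chain {k k' : ℕ} (hk : k ≤ k') (h : PolyPumpE k) : PolyPumpE k' :=
  fun p _ hp => polyPumpE_of_le hk (h p hp)

/-- the even ladder from `BASE` at `(4, 0)`: after `m` pumps, no degree-`m` unity at `4 + 6·gadgetSum k m`. -/
theorem polyPumpE_ladder {k : ℕ} (hP : PolyPumpEAt p k) :
    ∀ m : ℕ, ¬ UnityAt (ZMod p) (4 + 6 * gadgetSum k m) 0 m := by
  intro m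
  induction m with
  | zero =>
    rw [gadgetSum_zero, Nat.mul_zero, Nat.add_zero]
    exact noConstantUnity 4 0 (by omega) (Or.inr ⟨by decide, by decide⟩)
  | succ m ih =>
    have h := hP (4 + 6 * gadgetSum k m) 0 m (by omega) ⟨by omega, by omega⟩ ih
    rw [gadgetSum_succ, Nat.mul_add, ← Nat.add_assoc]
    exact h

/-- degree form via law M: `n ≥ 4 + 6·m^(k+1)` ⟹ no degree-`m` unity on ANY K-hard board of length `n`. -/
theorem polyPumpE_degree {k : ℕ} (hP : PolyPumpEAt p k) {m n c : ℕ} (hn : 4 + 6 * m ^ (k + 1) ≤ n)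
    (hK : KHard n c) : ¬ UnityAt (ZMod p) n c m := by
  have hS := gadgetSum_le k m
  exact stair_from (K := ZMod p) (m₀ := 4 + 6 * gadgetSum k m) (c₀ := 0) (by omega) (by omega)
    (polyPumpE_ladder hP m) n c (by omega) hK

/-- `noUnityHard_of_polyPumpE` (PumpDial g25, section PolyPumpE). -/
theorem noUnityHard_of_polyPumpE {k : ℕ} (hP : PolyPumpEAt p k) : NoUnityHardAt p := by
  intro C
  obtain ⟨n₀, h₀⟩ := polylog_gadget_le C k
  exact ⟨n₀, fun n hn c hH => polyPumpE_degree hP (h₀ n hn) (Or.inl hH)⟩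

/-- `noUnityEven_of_polyPumpE` (PumpDial g25, section PolyPumpE). -/
theorem noUnityEven_of_polyPumpE {k : ℕ} (hP : PolyPumpEAt p k) : NoUnityEvenAt p := by
  intro C
  obtain ⟨n₀, h₀⟩ := polylog_gadget_le C k
  exact ⟨n₀, fun n hn c hE => polyPumpE_degree hP (h₀ n hn) (Or.inr hE)⟩

/-- **`PolyPumpE k → B_K`** for any fixed `k` (g24's crux BY NAME). -/
theorem closes_K_polyE {k : ℕ} (hP : PolyPumpE k) : NoUnityHardOdd :=
  fun p _ hp => noUnityHard_of_polyPumpE (hP p hp)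

/-- `PolyPumpE k → B`. -/
theorem closes_B_polyE {k : ℕ} (hP : PolyPumpE k) : NoOneLiveHardOdd := bK_imp_b (closes_K_polyE hP)

end PolyPumpE

section EvenCut

variable {K : Type*} [Field K] {n : ℕ}

/-! ## §20 REV 3 — the EVEN-CUT rung and the pair symmetry (the «TRIT GAME»)

EMPIRICAL LAW E (data `slack_and_support_runs.txt`, `trit_runs*.txt`): on every exactly decided board the least unity
degree is ALREADY attained by a unity supported on the EVEN cuts `{0, 2, 4, …}` ((8,0) 3, (9,0) 4, (10,0) 4, (11,2) 4,
(12,1) 4; supports missing the last cut fail).  Within-pair swaps `(2j, 2j+1)` of the input fix the liveness of every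
EVEN cut (`liveInd_comp_pairSwap`: an even cut has both positions of a pair on the same side), so even-cut unities
map to even-cut unities (`evenCutUnity_comp_pairSwap`, law SW) and may be averaged to pair-symmetric ones
(`evenCutUnityAt_symm`, char ≠ 2); a pair-symmetric multilinear polynomial of degree `d` is exactly a polynomial of
total degree `d` (individual degrees ≤ 2) in the pair weights `w_j = u_{2j} + u_{2j+1} ∈ {0,1,2}` on the GRID
`{0,1,2}^{n/2}`, and cut `2i` is live iff the AFFINE form `c + 2i + Σ_{j<i} 2w_j + Σ_{j≥i} w_j ≢ 0 (mod 3)`: the TRIT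
GAME.  Its least degree `T(m)` is computed EXACTLY for every even `m ≤ 18`: `T(6..18) = 2,3,4,4,5,6,6 = ⌈m/3⌉`
(= `D(m)` wherever `D` is known, and = the Beck–Li immunity of `¬MOD₃`), two boards beyond the reach of the cube
elimination.  `EVEN-THIRD` is the corresponding RUNG of `THIRD`: implied by it (`evenCutThird_of_third`), a statement
about polynomials on the grid `{0,1,2}^k` with `k+1` families of parallel affine hyperplanes mod 3 (normals
interpolating between `(1,…,1)` and `(2,…,2)`), and — if law E is a law — equivalent to it. -/

/-- **`EvenCutUnityAt K n c d`**: a unity of degree `d` on `(n, c)` supported on the even cuts. -/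
def EvenCutUnityAt (K : Type*) [Field K] (n c d : ℕ) : Prop :=
  ∃ Y : Fin (n + 1) → CubeFn K n, (∀ g, Y g ∈ lowDeg K n d) ∧ (∀ g, g.val % 2 = 1 → Y g = 0) ∧
    ∀ u, (∑ g, Y g u * liveInd K c g u) = 1

/-- an even-cut unity is a unity (the rung is a genuine special case). -/
theorem unityAt_of_evenCutUnityAt {c d : ℕ} (h : EvenCutUnityAt K n c d) : UnityAt K n c d := by
  obtain ⟨Y, hY, -, h1⟩ := h
  exact ⟨Y, hY, h1⟩

/-- `evenCutUnityAt_mono` (PumpDial g25, section EvenCut). -/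
theorem evenCutUnityAt_mono {c d d' : ℕ} (hd : d ≤ d') (h : EvenCutUnityAt K n c d) : EvenCutUnityAt K n c d' := by
  obtain ⟨Y, hY, h0, h1⟩ := h
  exact ⟨Y, fun g => lowDeg_mono hd (hY g), h0, h1⟩

/-- the transposition of the two input positions `2j, 2j+1` of pair `j`. -/
def pairSwap (j : ℕ) (hj : 2 * j + 1 < n) : Equiv.Perm (Fin n) :=
  Equiv.swap ⟨2 * j, by omega⟩ ⟨2 * j + 1, hj⟩

/-- `pairSwap_lt_iff` (PumpDial g25, section EvenCut). -/
theorem pairSwap_lt_iff {j : ℕ} (hj : 2 * j + 1 < n) {g : ℕ} (hg : g % 2 = 0) (i : Fin n) :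
    (pairSwap j hj i).val < g ↔ i.val < g := by
  unfold pairSwap
  rcases eq_or_ne i ⟨2 * j, by omega⟩ with h | h
  · subst h; rw [Equiv.swap_apply_left]; show 2 * j + 1 < g ↔ 2 * j < g; omega
  rcases eq_or_ne i ⟨2 * j + 1, hj⟩ with h' | h'
  · subst h'; rw [Equiv.swap_apply_right]; show 2 * j < g ↔ 2 * j + 1 < g; omega
  · rw [Equiv.swap_apply_of_ne_of_ne h h']

/-- `pairSwap_pairSwap` (PumpDial g25, section EvenCut). -/
theorem pairSwap_pairSwap {j : ℕ} (hj : 2 * j + 1 < n) (i : Fin n) : pairSwap j hj (pairSwap j hj i) = i :=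
  Equiv.swap_apply_self _ _ _

/-- `comp_pairSwap_pairSwap` (PumpDial g25, section EvenCut). -/
theorem comp_pairSwap_pairSwap {j : ℕ} (hj : 2 * j + 1 < n) (u : Fin n → Bool) :
    (u ∘ pairSwap j hj) ∘ pairSwap j hj = u := by
  funext i; simp [pairSwap_pairSwap]

/-- the walk exponent of an EVEN cut is invariant under the within-pair swap. -/
theorem walkExp_comp_pairSwap (u : Fin n → Bool) {j : ℕ} (hj : 2 * j + 1 < n) {g : ℕ} (hg : g % 2 = 0) :
    walkExp (u ∘ pairSwap j hj) g = walkExp u g := by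
  unfold walkExp
  rw [Summit.QuantumAdvantage.AdviceFreeQNC0.Coset21.wt_comp_perm]
  congr 1
  unfold wtPrefix
  refine Finset.card_equiv (pairSwap j hj) fun i => ?_
  simp only [Finset.mem_filter, Finset.mem_univ, true_and, Function.comp_apply, pairSwap_lt_iff hj hg]

/-- **even cuts do not see the order inside a pair.** -/
theorem liveInd_comp_pairSwap (c : ℕ) (g : Fin (n + 1)) (hg : g.val % 2 = 0) (u : Fin n → Bool) {j : ℕ}
    (hj : 2 * j + 1 < n) : liveInd K c g (u ∘ pairSwap j hj) = liveInd K c g u := by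
  unfold liveInd
  rw [walkExp_comp_pairSwap u hj hg]

/-- precomposition with a permutation of the positions preserves the degree filtration. -/
theorem comp_perm_mem_lowDeg {d : ℕ} (σ : Equiv.Perm (Fin n)) {P : CubeFn K n} (hP : P ∈ lowDeg K n d) :
    (fun u => P (u ∘ σ)) ∈ lowDeg K n d := by
  refine AdviceFreeQNC0.comp_mem_lowDeg_of_coord (fun u => u ∘ σ) (fun i => ?_) hP
  have : (fun u : Fin n → Bool => if (u ∘ σ) i = true then (1 : K) else 0) = mono K {σ i} := by
    funext u; simp [mono_apply]
  rw [this]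
  exact mono_mem_lowDeg (by simp)

/-- **law SW (pair symmetry).**  The within-pair swap maps even-cut unities of degree `d` to even-cut unities of
degree `d` (odd cuts carry `0`, even cuts have swap-invariant liveness). -/
theorem evenCutUnity_comp_pairSwap {c d : ℕ} {Y : Fin (n + 1) → CubeFn K n} (hY : ∀ g, Y g ∈ lowDeg K n d)
    (h0 : ∀ g, g.val % 2 = 1 → Y g = 0) (h1 : ∀ u, (∑ g, Y g u * liveInd K c g u) = 1)
    {j : ℕ} (hj : 2 * j + 1 < n) :
    (∀ g, (fun u => Y g (u ∘ pairSwap j hj)) ∈ lowDeg K n d) ∧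
    (∀ g, g.val % 2 = 1 → (fun u => Y g (u ∘ pairSwap j hj)) = 0) ∧
    ∀ u, (∑ g, Y g (u ∘ pairSwap j hj) * liveInd K c g u) = 1 := by
  refine ⟨fun g => comp_perm_mem_lowDeg _ (hY g), fun g hg => ?_, fun u => ?_⟩
  · funext u; simp [h0 g hg]
  · calc (∑ g, Y g (u ∘ pairSwap j hj) * liveInd K c g u)
        = ∑ g, Y g (u ∘ pairSwap j hj) * liveInd K c g (u ∘ pairSwap j hj) := by
          refine Finset.sum_congr rfl fun g _ => ?_
          rcases Nat.mod_two_eq_zero_or_one g.val with hg | hg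
          · rw [liveInd_comp_pairSwap (K := K) c g hg u hj]
          · simp [h0 g hg]
      _ = 1 := h1 _

/-- **symmetrization** (char ≠ 2): an even-cut unity may be taken invariant under the swap of pair `j`
(average `Y` with its swap; all pairs simultaneously by iterating, since the swaps commute — the invariant unities are
the polynomials of the TRIT GAME on the grid `{0,1,2}^{n/2}`). -/
theorem evenCutUnityAt_symm (h2 : (2 : K) ≠ 0) {c d : ℕ} (h : EvenCutUnityAt K n c d) {j : ℕ} (hj : 2 * j + 1 < n) :
    ∃ Y : Fin (n + 1) → CubeFn K n, (∀ g, Y g ∈ lowDeg K n d) ∧ (∀ g, g.val % 2 = 1 → Y g = 0) ∧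
      (∀ u, (∑ g, Y g u * liveInd K c g u) = 1) ∧ ∀ g u, Y g (u ∘ pairSwap j hj) = Y g u := by
  obtain ⟨Y, hY, h0, h1⟩ := h
  obtain ⟨hY', h0', h1'⟩ := evenCutUnity_comp_pairSwap hY h0 h1 hj
  refine ⟨fun g => (2 : K)⁻¹ • (Y g + fun u => Y g (u ∘ pairSwap j hj)), fun g => ?_, fun g hg => ?_, fun u => ?_,
    fun g u => ?_⟩
  · exact Submodule.smul_mem _ _ (Submodule.add_mem _ (hY g) (hY' g))
  · have e1 := h0' g hg
    have e0 := h0 g hg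
    show (2 : K)⁻¹ • (Y g + fun u => Y g (u ∘ pairSwap j hj)) = 0
    rw [e1, e0, add_zero, smul_zero]
  · have e : (∑ g, ((2 : K)⁻¹ • (Y g + fun u => Y g (u ∘ pairSwap j hj))) u * liveInd K c g u)
        = (2 : K)⁻¹ * ((∑ g, Y g u * liveInd K c g u) + ∑ g, Y g (u ∘ pairSwap j hj) * liveInd K c g u) := by
      rw [← Finset.sum_add_distrib, Finset.mul_sum]
      refine Finset.sum_congr rfl fun g _ => ?_
      simp only [Pi.smul_apply, Pi.add_apply, smul_eq_mul]
      ring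
    rw [e, h1, h1']
    field_simp
    norm_num
  · simp only [Pi.smul_apply, Pi.add_apply]
    rw [comp_pairSwap_pairSwap, add_comm]

/-- the END-CUT unities of §18 are even-cut unities when `n` is even (so `not_endUnityAt` is the `{0, n}` case of
`EVEN-THIRD`, with the right constant). -/
theorem evenCutUnityAt_of_endUnityAt {c d : ℕ} (hn : n % 2 = 0) (hn2 : 2 ≤ n) (h : EndUnityAt K n c d) :
    EvenCutUnityAt K n c d := by
  obtain ⟨Y₀, Y₁, hY₀, hY₁, h1⟩ := h
  refine ⟨fun g => if g = 0 then Y₀ else if g = Fin.last n then Y₁ else 0, fun g => ?_, fun g hg => ?_, fun u => ?_⟩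
  · by_cases hg0 : g = 0
    · simp only [hg0, if_true]; exact hY₀
    · by_cases hg1 : g = Fin.last n
      · simp only [hg1, if_true]; rw [if_neg (fun h => hg0 (hg1.trans h))]; exact hY₁
      · simp only [hg0, hg1, if_false]; exact Submodule.zero_mem _
  · have hg0 : g ≠ 0 := by rintro rfl; simp at hg
    have hg1 : g ≠ Fin.last n := by rintro rfl; simp [Fin.val_last] at hg; omega
    simp [hg0, hg1]
  · have hne : (0 : Fin (n + 1)) ≠ Fin.last n := by
      intro h; have := congrArg Fin.val h; simp [Fin.val_last] at this; omega
    rw [← h1 u, ← Finset.sum_subset (Finset.subset_univ ({0, Fin.last n} : Finset (Fin (n + 1))))]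
    · rw [Finset.sum_pair hne]
      simp only [if_true, if_neg hne.symm]
    · intro g _ hg
      simp only [Finset.mem_insert, Finset.mem_singleton, not_or] at hg
      simp [hg.1, hg.2]

end EvenCut

section EvenThird

variable {p : ℕ} [Fact p.Prime]


/-- **`EVEN-THIRD`** [rung of `THIRD` · conjecture · the trit game]: no even-cut unity of degree `d` with `3d < n`
on an even off-diagonal board.  DECIDED (true) for every even `n ≤ 18` by exact elimination in the trit game
(`trit_runs*.txt`: `T(6..18) = ⌈m/3⌉`), i.e. two boards beyond `THIRD`'s exact range; its `{0,n}`-supported case is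
the kernel theorem `not_endUnityAt` (any `n`, any field of char `≠ 3`). -/
def EvenCutThirdAt (p : ℕ) [Fact p.Prime] : Prop :=
  ∀ n c d : ℕ, 4 ≤ n → EvenOff n c → 3 * d < n → ¬ EvenCutUnityAt (ZMod p) n c d

/-- `EvenCutThird` (PumpDial g25, section EvenThird). -/
def EvenCutThird : Prop := ∀ (p : ℕ) [Fact p.Prime], 5 ≤ p → EvenCutThirdAt p

/-- `THIRD ⟹ EVEN-THIRD` (the rung is weaker). -/
theorem evenCutThird_of_third (hT : UnityThirdAt p) : EvenCutThirdAt p := by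
  intro n c d hn hE hd hU
  have h2 := hE.1
  refine hT n c hn (Or.inr hE) (unityAt_mono _ ?_ (unityAt_of_evenCutUnityAt hU))
  omega

/-- `evenCutThird_of_third'` (PumpDial g25, section EvenThird). -/
theorem evenCutThird_of_third' (hT : UnityThird) : EvenCutThird := fun p _ hp => evenCutThird_of_third (hT p hp)

/-- the end-cut case of `EVEN-THIRD`, unconditionally (from §18). -/
theorem evenCutThird_endCase (hp : 5 ≤ p) {n c d : ℕ} (hE : EvenOff n c) (hd : 3 * d + 2 ≤ n) :
    ¬ EndUnityAt (ZMod p) n c d :=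
  not_endUnityAt_zmod hp (n := n) hE.2 hd

end EvenThird

end Summit.QuantumAdvantage.QuantumAdvantage.Theorems.PumpDial
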